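import Summits.BirchSwinnertonDyer.BirchSwinnertonDyer.Theorems.ManinLocalTwoThreeManinPrimeToThreeAtNineCoreByLevel
import Summits.BirchSwinnertonDyer.BirchSwinnertonDyer.Theorems.ManinLocalTwoThreeSemistableTwistTameAtThree
import HarnessLib

/-!
# WILD AT `3` ⟹ POTENTIALLY SUPERSINGULAR: `27 ∣ N(W)` forces `|j(W)|₃ < 1` (`j = 0` or `ord₃ j > 0`)
# (route `ManinLocalTwoThree`, crux C3 `ManinPrimeToThreeAtNine` stmt-BirchSwinnertonDyer-22968; cell bsd-f2-manin, p2 gen 15)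

Composition of this seat's two local laws at `3`: `27 ∣ N(W)` makes EVERY quadratic twist of `W` additive at `3`
(`hasAdditiveReductionAt_quadraticTwist_placeOf_three_of_twentyseven_dvd`, Swan road, p707513), while `|j|₃ ≥ 1` together with additivity would
make the ternary twist `W ⊗ ℚ(√−3)` semistable (`isSemistableAt_quadraticTwist_negThree_of_one_le_valuation_j_of_hasAdditiveReductionAt`, Tate
form, p706475).  Hence on the WILD stratum `27 ∣ N` the potentially-supersingular binder of the C3 core is AUTOMATIC (an's S-an-43 hypothesis
`ord₃ j ≥ 0` is not only idle but strict: `ord₃ j > 0` or `j = 0`); equivalently every potentially multiplicative or potentially ordinary curve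
has `v₃(N) ≤ 2` (Serre–Tate: semistability defect `2` is tame).
HONEST FRAMING: local structure theorem; nothing about BSD, Manin's conjecture or C3 is proved.  No definitions, no named facts, no sorry.
[cite: SilvermanATAEC1994, Thm. IV.10.2, IV.11.1 (p = 3)] [cite: SilvermanAEC2009, VII.5 Prop. 5.1 and X.5 Cor. 5.4.1] [cite: SerreTate1968, §2 Cor. 2]
-/

set_option autoImplicit false
-- lint-debt: the directory name repeats the summit name (sibling precedent `ManinLocalTwoThreeSemistableTwistTameAtThree.lean`)
set_option linter.dupNamespace false

noncomputable section

open scoped Classical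
open WeierstrassCurve IsDedekindDomain IsDedekindDomain.HeightOneSpectrum Rat.HeightOneSpectrum
  Literature.NumberTheory.DiophantineGeometry Literature.NumberTheory.EllipticCurves
  Literature.NumberTheory.EllipticCurves.ModularForms
  Summit.BirchSwinnertonDyer.Rank1Residual.Additive

namespace Summit.BirchSwinnertonDyer.BirchSwinnertonDyer.Theorems.ManinLocalTwoThree

/-- **`27 ∣ N(W)` ⟹ `|j(W)|₃ < 1`** (wild at `3` ⟹ potentially supersingular at `3`).
[cite: SilvermanATAEC1994, Thm. IV.10.2, IV.11.1 (p = 3)] [cite: SilvermanAEC2009, VII.5 Prop. 5.1 and X.5 Cor. 5.4.1] -/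
theorem valuation_j_lt_one_of_twentyseven_dvd_conductorNorm (W : WeierstrassCurve ℚ) [W.IsElliptic]
    (h27 : 3 ^ 3 ∣ W.conductorNorm ℤ) : (placeOf 3).valuation ℚ W.j < 1 := by
  haveI : PerfectField (IsLocalRing.ResidueField ((placeOf 3).adicCompletionIntegers ℚ)) := PerfectField.ofFinite
  have hd0 : ((-3 : ℤ) : ℚ) ≠ 0 := by norm_num
  haveI := W.isElliptic_quadraticTwist hd0
  have hgen : natGenerator (placeOf 3) = 3 := congrArg Subtype.val ((primesEquiv (R := ℤ)).apply_symm_apply ⟨3, Nat.prime_three⟩)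
  -- `W` is additive at `3` (`9 ∣ N`)
  have hadd : W.HasAdditiveReductionAt (placeOf 3) := by
    have hfac : (W.conductorNorm ℤ).factorization 3 = W.conductorExponent (placeOf 3) :=
      factorization_conductorNorm_primesEquiv_symm W ⟨3, Nat.prime_three⟩
    refine (two_le_conductorExponent_iff_holds (placeOf 3) W).mp ?_
    rw [← hfac]
    have h3 := (Nat.prime_three.pow_dvd_iff_le_factorization (W.conductorNorm_pos_holds).ne').mp h27
    omega
  -- every quadratic twist is additive at `3`; but `|j|₃ ≥ 1` would make `W ⊗ (−3)` semistable
  have htw := hasAdditiveReductionAt_quadraticTwist_placeOf_three_of_twentyseven_dvd W h27 hd0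
  by_contra hj
  rcases isSemistableAt_quadraticTwist_negThree_of_one_le_valuation_j_of_hasAdditiveReductionAt (placeOf 3) hgen W (not_lt.mp hj) hadd with
    hg | hm
  · exact htw.not_hasGoodReductionAt hg
  · exact htw.not_hasMultiplicativeReductionAt hm

/-- **`27 ∣ N(W)` ⟹ `j(W) = 0` or `ord₃ j(W) > 0`** (`padicValRat` currency of the cell). [cite: SilvermanATAEC1994, Thm. IV.11.1 (p = 3)] -/
theorem j_eq_zero_or_padicValRat_j_pos_of_twentyseven_dvd_conductorNorm (W : WeierstrassCurve ℚ) [W.IsElliptic]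
    (h27 : 3 ^ 3 ∣ W.conductorNorm ℤ) : W.j = 0 ∨ 0 < padicValRat 3 W.j :=
  (valuation_placeOf_three_lt_one_iff W.j).mp (valuation_j_lt_one_of_twentyseven_dvd_conductorNorm W h27)

/-- **Contrapositive: `ord₃ j ≤ 0` (`j ≠ 0`) ⟹ `27 ∤ N(W)`** — every potentially multiplicative or potentially good ordinary curve is at worst
TAME at `3` (`v₃(N) ≤ 2`). [cite: SilvermanATAEC1994, Thm. IV.10.2, IV.11.1 (p = 3)] [cite: SerreTate1968, §2 Cor. 2] -/
theorem not_twentyseven_dvd_conductorNorm_of_padicValRat_j_nonpos (W : WeierstrassCurve ℚ) [W.IsElliptic]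
    (hj0 : W.j ≠ 0) (hj : padicValRat 3 W.j ≤ 0) : ¬ 3 ^ 3 ∣ W.conductorNorm ℤ := fun h27 ↦ by
  rcases j_eq_zero_or_padicValRat_j_pos_of_twentyseven_dvd_conductorNorm W h27 with h | h
  · exact hj0 h
  · exact absurd hj (not_le.mpr h)

/-- **At the datum level** (modularity identifies the level with the conductor): for an `X₀(N)`-datum of `W` with `27 ∣ N`, `j(W) = 0 ∨ ord₃ j(W) > 0`.
[cite: SilvermanATAEC1994, Thm. IV.11.1 (p = 3)] [cite: DiamondShurman2005, Thm. 8.8.1] -/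
theorem j_eq_zero_or_padicValRat_j_pos_of_twentyseven_dvd_level (hnf : exists_isNewformOf)
    {W : WeierstrassCurve ℚ} [W.IsElliptic] {N : ℕ} [NeZero N] (D : ModularParametrizationData W N) (h27 : 3 ^ 3 ∣ N) :
    W.j = 0 ∨ 0 < padicValRat 3 W.j := by
  have hN : N = W.conductorNorm ℤ := IsNewformOf.level_eq_conductorNorm_of_exists_isNewformOf hnf D.isNewformOf
  exact j_eq_zero_or_padicValRat_j_pos_of_twentyseven_dvd_conductorNorm W (hN ▸ h27)

end Summit.BirchSwinnertonDyer.BirchSwinnertonDyer.Theorems.ManinLocalTwoThree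

end
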